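import Mathlib
import Summits.Ventures.PercRepro2.SwOutCrossBaseBlockM
import Summits.Ventures.PercRepro2.SwOutCrossGenMarkQ

/-!
# The cross base with THE MARK AT A DROPPED VERTEX: the type lemma and the block theorem (blind
cell PercRepro2, night-4 g26, 2026-08-28; proofs/NIGHT4-G26.md §3″)

The mark `o = p r` is a dropped vertex of the cross component.  The landed type lemma
(`mem_tgtU_of_betterFM_mark`) excludes it: red connection from `l` to `p r` through a red link from
a red port is not recorded by the landed label.  With THE LINK RECORD `fibKEEQMin G r`
(`SwOutCrossGenMarkQ`: the landed label with the red ports red-linked to `r` and the blue ports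
blue-linked to `r`), the order unpacks to the landed five clauses and the two link clauses
(`betterFMQ_iff`), reverses under the flip (`betterFMQ_flip`), and the last crossing segment of a
red walk from `l` to `p r` — a red port `p i` joined to the anchor, linked to `r` in the link
graph of `x` — is carried to `x'` by the link clause (`conn_mono_markQ`); blue connection is the
dual (`conn_blue_anti_markQ`); **`mem_tgtU_of_betterFMQ`** is the type lemma with the mark at
`p r`, and **`rigid_block_crossMQ`** / **`rigid_block_crossQ`** the block theorem: the rigid
counting inequality of (SW) on the block of a cross base with the mark at a dropped vertex, for
every up-set of edge sets — from `card_le_crossGenFarM` on the link record, whose inequality is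
`ineqM_fibKEEQ`.  (The class partition of the junction with the mark at a dropped vertex is the
landed one; its structure `CrossJunction` carries `o ≠ p i` only to give every dropped vertex an
outside edge, which here is a hypothesis on the mark.)
-/

namespace Summit.Ventures.PercRepro2

namespace CrossArm

open Hull LocRows

variable {V E : Type*}

open scoped Classical

section Order

variable {ι X κ : Type*} {G : SimpleGraph X} (r : X)

/-- The order of `card_le_crossGenFarM` on the link record, unpacked: the landed five clauses,
the red ports red-linked to the mark kept, the blue ports blue-linked to the mark of the better
point already present. -/
lemma betterFMQ_iff {x x' : PtXG ι κ X G} :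
    BetterFM (fibKEEQMin G r) (typFM (fibKEEQMin G r) (toGen G x'))
        (typFM (fibKEEQMin G r) (toGen G x)) ↔
      (∀ k, x.1 k = false → x'.1 k = false) ∧ (∀ j, x.2.1 j = false → x'.2.1 j = false) ∧
        ((∀ i, x.2.2.2.2 i = false → x'.2.2.2.2 i = false) ∧
          (∀ i j, x.2.2.2.2 i = false ∧ x.2.2.2.2 j = false ∧ rlinkE G x.2.2 i j →
            x'.2.2.2.2 i = false ∧ x'.2.2.2.2 j = false ∧ rlinkE G x'.2.2 i j) ∧
          (∀ i j, x'.2.2.2.2 i = true ∧ x'.2.2.2.2 j = true ∧ rlinkE G x'.2.2.flip i j →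
            x.2.2.2.2 i = true ∧ x.2.2.2.2 j = true ∧ rlinkE G x.2.2.flip i j)) ∧
        (∀ j, x.2.2.2.2 j = false ∧ rlinkE G x.2.2 r j →
          x'.2.2.2.2 j = false ∧ rlinkE G x'.2.2 r j) ∧
        (∀ j, x'.2.2.2.2 j = true ∧ rlinkE G x'.2.2.flip r j →
          x.2.2.2.2 j = true ∧ rlinkE G x.2.2.flip r j) :=
  Iff.rfl

/-- The order on the link record is reflexive. -/
lemma betterFMQ_refl (x : PtXG ι κ X G) :
    BetterFM (fibKEEQMin G r) (typFM (fibKEEQMin G r) (toGen G x))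
      (typFM (fibKEEQMin G r) (toGen G x)) :=
  (betterFMQ_iff r).2 ⟨fun _ h => h, fun _ h => h, ⟨fun _ h => h, fun _ _ h => h, fun _ _ h => h⟩,
    fun _ h => h, fun _ h => h⟩

/-- The order on the link record is transitive. -/
lemma betterFMQ_trans {t₁ t₂ t₃ : TypFG (LabelKEQ X) ι κ} (h₁ : BetterFM (fibKEEQMin G r) t₂ t₁)
    (h₂ : BetterFM (fibKEEQMin G r) t₃ t₂) : BetterFM (fibKEEQMin G r) t₃ t₁ :=
  ⟨fun k hk => h₂.1 k (h₁.1 k hk), fun j hj => h₂.2.1 j (h₁.2.1 j hj),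
    betterKE_trans h₁.2.2.1 h₂.2.2.1, fun j hj => h₂.2.2.2.1 j (h₁.2.2.2.1 j hj),
    fun j hj => h₁.2.2.2.2 j (h₂.2.2.2.2 j hj)⟩

/-- **The order reverses under the flip**: `x ≤ x'` gives `flip x' ≤ flip x` (the two link
clauses exchange). -/
lemma betterFMQ_flip {x x' : PtXG ι κ X G}
    (hord : BetterFM (fibKEEQMin G r) (typFM (fibKEEQMin G r) (toGen G x'))
      (typFM (fibKEEQMin G r) (toGen G x))) :
    BetterFM (fibKEEQMin G r) (typFM (fibKEEQMin G r) (toGen G (flipXG G x)))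
      (typFM (fibKEEQMin G r) (toGen G (flipXG G x'))) := by
  rw [betterFMQ_iff] at hord ⊢
  obtain ⟨hfar, harm, ⟨hext, hlink, hblink⟩, hRQ, hBQ⟩ := hord
  refine ⟨?_, ?_, ⟨?_, ?_, ?_⟩, ?_, ?_⟩
  · intro k hk
    rw [flipXG_far, Bool.not_eq_false'] at hk ⊢
    cases hxk : x.1 k
    · exact absurd (hfar k hxk) (by rw [hk]; decide)
    · rfl
  · intro j hj
    rw [flipXG_arm, Bool.not_eq_false'] at hj ⊢
    cases hxj : x.2.1 j
    · exact absurd (harm j hxj) (by rw [hj]; decide)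
    · rfl
  · intro i hi
    rw [flipXG_ext, Bool.not_eq_false'] at hi ⊢
    cases hxi : x.2.2.2.2 i
    · exact absurd (hext i hxi) (by rw [hi]; decide)
    · rfl
  · intro i j hij
    rw [flipXG_ext, flipXG_ext, flipXG_fib, Bool.not_eq_false', Bool.not_eq_false'] at hij
    rw [flipXG_ext, flipXG_ext, flipXG_fib, Bool.not_eq_false', Bool.not_eq_false']
    exact hblink i j hij
  · intro i j hij
    rw [flipXG_ext, flipXG_ext, flipXG_fib, FibKE.flip_flip, Bool.not_eq_true',
      Bool.not_eq_true'] at hij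
    rw [flipXG_ext, flipXG_ext, flipXG_fib, FibKE.flip_flip, Bool.not_eq_true',
      Bool.not_eq_true']
    exact hlink i j hij
  · intro j hj
    rw [flipXG_ext, flipXG_fib, Bool.not_eq_false'] at hj
    rw [flipXG_ext, flipXG_fib, Bool.not_eq_false']
    exact hBQ j hj
  · intro j hj
    rw [flipXG_ext, flipXG_fib, FibKE.flip_flip, Bool.not_eq_true'] at hj
    rw [flipXG_ext, flipXG_fib, FibKE.flip_flip, Bool.not_eq_true']
    exact hRQ j hj

end Order

section Mark

variable {ends : E → Sym2 V} {σ : Config E} {h u : V} {ι X κ : Type*} {U : ι → Set V}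
  {p : X → V} {G : SimpleGraph X} {F : κ → Set V} (hb : CrossBase ends σ h u U p G F)
include hb

/-- **Red connection from outside the structure to the dropped vertex `p r` is monotone in the
link order**: the last crossing segment of the red walk ends at `p r` through a red port `p i`
joined to the anchor and linked to `r`; the link clause carries the port and the link to the
better point, where the port's outside edge is red and the link is a red path. -/
theorem CrossBase.conn_mono_markQ (hup : ∀ i, ∃ e, ends e = s(u, p i))
    (hcross : ∀ i j, G.Adj i j → ∃ e, ends e = s(p i, p j)) {x x' : PtXG ι κ X G}
    (hxL : ¬ LeakRX G x) (harm : ∀ j, x.2.1 j = false → x'.2.1 j = false)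
    (hfar : ∀ k, x.1 k = false → x'.1 k = false)
    (hext : ∀ i, x.2.2.2.2 i = false → x'.2.2.2.2 i = false)
    (hlink : ∀ i m, x.2.2.2.2 i = false → x.2.2.2.2 m = false → rlinkE G x.2.2 i m →
      rlinkE G x'.2.2 i m)
    {r : X} (hlinkQ : ∀ i, x.2.2.2.2 i = false → rlinkE G x.2.2 i r →
      x'.2.2.2.2 i = false ∧ rlinkE G x'.2.2 i r)
    {l : V} (hl : l ∉ strX h u U p F)
    (hlh : ¬ Conn ends (crossReal ends u U p G F σ x) l h)
    (hlo : Conn ends (crossReal ends u U p G F σ x) l (p r)) :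
    Conn ends (crossReal ends u U p G F σ x') l (p r) := by
  -- the red walk from `l` ends inside the structure: its last crossing segment reaches `p r`
  have key : ∀ v, Conn ends (crossReal ends u U p G F σ x) l v →
      (v ∉ strX h u U p F ∧ Conn ends (crossReal ends u U p G F σ x') l v) ∨
        ∃ a, a ∉ strX h u U p F ∧ Conn ends (crossReal ends u U p G F σ x') l a ∧
          Conn ends (crossReal ends u U p G F σ x) l a ∧
          SegX ends (crossReal ends u U p G F σ x) (strX h u U p F) a v := by
    intro v hv
    rw [Conn, SimpleGraph.reachable_iff_reflTransGen] at hv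
    induction hv with
    | refl => exact Or.inl ⟨hl, conn_refl _ _ _⟩
    | @tail b c hab hbc ih =>
      by_cases hc : c ∈ strX h u U p F
      · rcases ih with ⟨hbO, hb'⟩ | ⟨a, haO, ha', hla, hseg⟩
        · refine Or.inr ⟨b, hbO, hb', ?_, Relation.ReflTransGen.single ⟨hbc, hc⟩⟩
          rw [Conn, SimpleGraph.reachable_iff_reflTransGen]
          exact hab
        · exact Or.inr ⟨a, haO, ha', hla, hseg.tail ⟨hbc, hc⟩⟩
      · rcases ih with ⟨hbO, hb'⟩ | ⟨a, haO, ha', hla, hseg⟩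
        · obtain ⟨hne, e, he, hends⟩ := exists_edge_of_adj hbc
          refine Or.inl ⟨hc, conn_trans hb'
            (SimpleGraph.Adj.reachable (adj_of_edge hne ?_ hends))⟩
          rw [hb.crossReal_apply_out hends hbO hc]
          rw [hb.crossReal_apply_out hends hbO hc] at he
          exact he
        · have hah : ¬ Conn ends (crossReal ends u U p G F σ x) h a :=
            fun hha => hlh (conn_trans hla (conn_symm hha))
          have hinv := hb.crossInv_of_segX hup hcross hxL harm hfar haO hah hseg
          exact Or.inl ⟨hc, conn_trans ha'
            (hb.conn_of_crossInv hup hcross harm hfar hext hlink haO hinv hbc hc)⟩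
  have hpr : p r ∈ strX h u U p F := Or.inr (Or.inr (Or.inl ⟨r, rfl⟩))
  rcases key (p r) hlo with ⟨ho', -⟩ | ⟨a, haO, ha', hla, hseg⟩
  · exact absurd hpr ho'
  · have hah : ¬ Conn ends (crossReal ends u U p G F σ x) h a :=
      fun hha => hlh (conn_trans hla (conn_symm hha))
    rcases hb.crossInv_of_segX hup hcross hxL harm hfar haO hah hseg with
      hoa | ⟨j, -, hpU, -⟩ | ⟨k, -, hpF, -⟩ | ⟨i, hi, ⟨e, he⟩, ov, hvo, hreach⟩
    · rw [hoa]
      exact ha'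
    · exact absurd hpU (hb.p_notMem_U r j)
    · exact absurd hpF (hb.p_notMem_F r k)
    · rcases ov with _ | m
      · exact absurd hvo (hb.hne_up r).symm
      · have hrm : r = m := hb.p_inj hvo
        subst hrm
        obtain ⟨hi', hl'⟩ := hlinkQ i hi hreach
        have haO' := haO
        rw [notMem_strX_iff] at haO'
        obtain ⟨-, hau, hap, -⟩ := haO'
        -- the outside edge of `p i` from the anchor is red at `x'`
        have hred : crossReal ends u U p G F σ x' e = true :=
          hb.ext_red_of_eq_false (ends_swap he) hau hap hi'
        have hne : a ≠ p i := hap i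
        have h1 : Conn ends (crossReal ends u U p G F σ x') a (p i) :=
          SimpleGraph.Adj.reachable (adj_of_edge hne hred he)
        -- the link from `i` to `r` is a red path at `x'`
        have h2 : Conn ends (crossReal ends u U p G F σ x') (p i) (p r) :=
          hb.conn_of_linkWalk hup hcross (q := x') hl'.some
        exact conn_trans ha' (conn_trans h1 h2)

/-- **Blue connection to the dropped vertex `p r` is antitone in the link order** (the dual). -/
theorem CrossBase.conn_blue_anti_markQ (hup : ∀ i, ∃ e, ends e = s(u, p i))
    (hcross : ∀ i j, G.Adj i j → ∃ e, ends e = s(p i, p j)) {x x' : PtXG ι κ X G}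
    (hx'B : ¬ LeakBX G x') {r : X}
    (hord : BetterFM (fibKEEQMin G r) (typFM (fibKEEQMin G r) (toGen G x'))
      (typFM (fibKEEQMin G r) (toGen G x)))
    {l : V} (hl : l ∉ strX h u U p F)
    (hlh : ¬ Conn ends (blue (crossReal ends u U p G F σ x')) l h)
    (hlo : Conn ends (blue (crossReal ends u U p G F σ x')) l (p r)) :
    Conn ends (blue (crossReal ends u U p G F σ x)) l (p r) := by
  rw [hb.blue_crossReal] at hlh hlo ⊢
  obtain ⟨hfar, harm, ⟨hext, hlink, -⟩, hRQ, -⟩ := (betterFMQ_iff r).1 (betterFMQ_flip r hord)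
  exact hb.dual.conn_mono_markQ hup hcross hx'B harm hfar hext
    (fun i m hi hm hr => (hlink i m ⟨hi, hm, hr⟩).2.2)
    (fun i hi hr => ⟨(hRQ i ⟨hi, hr.symm⟩).1, (hRQ i ⟨hi, hr.symm⟩).2.symm⟩) hl hlh hlo

/-- **THE TYPE LEMMA WITH THE MARK AT A DROPPED VERTEX.** For non-leaking points `x ≤ x'` in the
link order and `l` outside the structure: if the realisation of `x` lies in the pulled-back
conditioning `tgtU l h {S | p r ∈ S}`, so does the realisation of `x'`. -/
theorem CrossBase.mem_tgtU_of_betterFMQ [Fintype E] [DecidableEq E]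
    (hup : ∀ i, ∃ e, ends e = s(u, p i))
    (hcross : ∀ i j, G.Adj i j → ∃ e, ends e = s(p i, p j)) {x x' : PtXG ι κ X G}
    (hxR : ¬ LeakRX G x) (hx'R : ¬ LeakRX G x') (hx'B : ¬ LeakBX G x') {r : X}
    (hord : BetterFM (fibKEEQMin G r) (typFM (fibKEEQMin G r) (toGen G x'))
      (typFM (fibKEEQMin G r) (toGen G x)))
    {l : V} (hl : l ∉ strX h u U p F)
    (hx : crossReal ends u U p G F σ x ∈ tgtU ends l h {S | p r ∈ S}) :
    crossReal ends u U p G F σ x' ∈ tgtU ends l h {S | p r ∈ S} := by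
  simp only [tgtU, Finset.mem_filter, Finset.mem_univ, true_and, Set.mem_setOf_eq,
    mem_cluster] at hx ⊢
  obtain ⟨hxh, hxo, hxb⟩ := hx
  obtain ⟨hfar, harm, ⟨hext, hlink, -⟩, hRQ, -⟩ := (betterFMQ_iff r).1 hord
  have hlh : ¬ Conn ends (crossReal ends u U p G F σ x) l h := fun hc => hxh (Or.inl hc)
  have h1 : h ∉ hull ends (crossReal ends u U p G F σ x') l := by
    intro hh
    have hlh' : l ∈ hull ends (crossReal ends u U p G F σ x') h := by
      rcases hh with hh | hh
      · exact Or.inl (conn_symm hh)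
      · exact Or.inr (conn_symm hh)
    exact hl (hb.hull_crossReal_subset hup hcross hx'R hx'B hlh')
  refine ⟨h1, ?_, ?_⟩
  · exact hb.conn_mono_markQ hup hcross hxR harm hfar hext
      (fun i m hi hm hr => (hlink i m ⟨hi, hm, hr⟩).2.2)
      (fun i hi hr => ⟨(hRQ i ⟨hi, hr.symm⟩).1, (hRQ i ⟨hi, hr.symm⟩).2.symm⟩) hl hlh hxo
  · intro hc
    exact hxb (hb.conn_blue_anti_markQ hup hcross hx'B hord hl (fun hc' => h1 (Or.inr hc')) hc)

end Mark

section Block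

variable {ι X κ : Type*} [Fintype ι] [DecidableEq ι] [Nonempty ι] [Fintype κ] [DecidableEq κ]
  [Fintype X] [DecidableEq X] [Nonempty X] {G : SimpleGraph X} [DecidableRel G.Adj]
  [Fintype E] [DecidableEq E]

variable {ends : E → Sym2 V} {σ : Config E} {h u : V} {U : ι → Set V} {p : X → V}
  {F : κ → Set V}

omit [Fintype ι] [DecidableEq ι] [Nonempty ι] [Fintype κ] [DecidableEq κ] [Fintype X]
  [DecidableEq X] [Nonempty X] [DecidableRel G.Adj] [Fintype E] [DecidableEq E] in
/-- The leak of the link record is the leak of the `KE` record. -/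
lemma leakM_Q_iff (r : X) (q : PtXG ι κ X G) :
    LeakM (fibKEEQMin G r) (toGen G q).2 ↔ LeakRX G q ∨ LeakBX G q :=
  leakM_toGen_iff q

omit [Fintype ι] [DecidableEq ι] [Nonempty ι] [Fintype κ] [DecidableEq κ] [Fintype X]
  [DecidableEq X] [Nonempty X] [DecidableRel G.Adj] [Fintype E] [DecidableEq E] in
/-- The red atoms of the link record are those of the `KE` record. -/
lemma ERFM_Q (r : X) (x : PtFG (FibKE X G) ι κ) : ERFM (fibKEEQMin G r) x = ERFM (fibKEEMin G) x :=
  rfl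

omit [Fintype ι] [DecidableEq ι] [Nonempty ι] [Fintype κ] [DecidableEq κ] [Fintype X]
  [DecidableEq X] [Nonempty X] [DecidableRel G.Adj] [Fintype E] [DecidableEq E] in
/-- The blue atoms of the link record are those of the `KE` record. -/
lemma EBFM_Q (r : X) (x : PtFG (FibKE X G) ι κ) : EBFM (fibKEEQMin G r) x = EBFM (fibKEEMin G) x :=
  rfl

variable (hb : CrossBase ends σ h u U p G F)
include hb

omit [Nonempty ι] [Nonempty X] in
/-- **THE BLOCK THEOREM WITH THE MARK AT A DROPPED VERTEX**: for a cross base whose link record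
at `r` has the inequality over the u-arms, the block satisfies the rigid counting inequality of
(SW) on its `Q`-part with the mark `p r`, for every up-set of edge sets. -/
theorem CrossBase.rigid_block_crossMQ {r : X} (hineq : IneqM (fibKEEQMin G r) (ι := ι))
    (hup : ∀ i, ∃ e, ends e = s(u, p i))
    (hcross : ∀ i j, G.Adj i j → ∃ e, ends e = s(p i, p j))
    (hcrossE : ∀ s : G.edgeSet, ∃ e, e ∈ clsCX ends p G s)
    (hFe : ∀ k, ∃ e, e ∈ touches ends (F k)) (hext : ∀ i, ∃ e, e ∈ clsExtX ends u p i)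
    {l : V} (hl : l ∉ strX h u U p F) {𝓔 : Set (Set E)} (h𝓔 : IsUpperSet 𝓔) :
    ((blockCX ends σ u U p G F).filter fun ζ =>
        ζ ∈ (tgtU ends l h {S : Set V | p r ∈ S} : Set (Config E)) ∧
          redEdges ends ζ h ∈ 𝓔).card ≤
      ((blockCX ends σ u U p G F).filter fun ζ =>
        ζ ∈ (tgtU ends l h {S : Set V | p r ∈ S} : Set (Config E)) ∧
          blueEdges ends ζ h ∈ 𝓔).card := by
  have hinj := hb.crossReal_injective hFe hup hcrossE hext
  -- the up-closure of the types of the conditioning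
  let 𝒯 : Set (TypFG (LabelKEQ X) ι κ) := {t | ∃ q : PtXG ι κ X G, ¬ LeakRX G q ∧ ¬ LeakBX G q ∧
    crossReal ends u U p G F σ q ∈ (tgtU ends l h {S : Set V | p r ∈ S} : Set (Config E)) ∧
    BetterFM (fibKEEQMin G r) t (typFM (fibKEEQMin G r) (toGen G q))}
  have h𝒯 : IsUpFM (fibKEEQMin G r) 𝒯 := by
    rintro t ⟨q, hqR, hqB, hq, hle⟩ t' hle'
    exact ⟨q, hqR, hqB, hq, betterFMQ_trans r hle hle'⟩
  -- the pulled-back conditioning is `QFM 𝒯` (the type lemma)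
  have hQ : QFM (fibKEEQMin G r) 𝒯 = Finset.univ.filter fun q : PtXG ι κ X G =>
      ¬ LeakRX G q ∧ ¬ LeakBX G q ∧
        crossReal ends u U p G F σ q ∈ (tgtU ends l h {S : Set V | p r ∈ S} : Set (Config E)) := by
    ext q
    simp only [QFM, Finset.mem_filter, Finset.mem_univ, true_and]
    have hleak : ¬ LeakM (fibKEEQMin G r) q.2 ↔ ¬ (LeakRX G q ∨ LeakBX G q) :=
      (leakM_Q_iff r q).not
    rw [hleak, not_or]
    constructor
    · rintro ⟨⟨hqR, hqB⟩, q₀, hq₀R, hq₀B, hq₀, hle⟩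
      exact ⟨hqR, hqB, hb.mem_tgtU_of_betterFMQ hup hcross hq₀R hqR hqB hle hl hq₀⟩
    · rintro ⟨hqR, hqB, hq⟩
      exact ⟨⟨hqR, hqB⟩, q, hqR, hqB, hq, betterFMQ_refl r q⟩
  have h𝓔' : IsUpperSet (φX ends σ h u U p G F ⁻¹' 𝓔) :=
    h𝓔.preimage (φX_mono ends σ h u U p G F)
  have key := card_le_crossGenFarM (F := fibKEEQMin G r) hineq h𝒯 h𝓔'
  have e1 : ((blockCX ends σ u U p G F).filter fun ζ =>
      ζ ∈ (tgtU ends l h {S : Set V | p r ∈ S} : Set (Config E)) ∧ redEdges ends ζ h ∈ 𝓔) =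
      ((QFM (fibKEEQMin G r) 𝒯).filter fun q => ERFM (fibKEEQMin G r) q ∈
        φX ends σ h u U p G F ⁻¹' 𝓔).image (crossReal ends u U p G F σ) := by
    ext ζ
    simp only [blockCX, hQ, Finset.mem_filter, Finset.mem_image, Finset.mem_univ, true_and,
      Set.mem_preimage]
    constructor
    · rintro ⟨⟨q, ⟨hqR, hqB⟩, rfl⟩, hq, hE⟩
      refine ⟨q, ⟨⟨hqR, hqB, hq⟩, ?_⟩, rfl⟩
      rw [hb.redEdges_crossRealM hup hcross hqR] at hE
      rw [ERFM_Q]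
      exact hE
    · rintro ⟨q, ⟨⟨hqR, hqB, hq⟩, hE⟩, rfl⟩
      refine ⟨⟨q, ⟨hqR, hqB⟩, rfl⟩, hq, ?_⟩
      rw [hb.redEdges_crossRealM hup hcross hqR]
      rw [ERFM_Q] at hE
      exact hE
  have e2 : ((blockCX ends σ u U p G F).filter fun ζ =>
      ζ ∈ (tgtU ends l h {S : Set V | p r ∈ S} : Set (Config E)) ∧ blueEdges ends ζ h ∈ 𝓔) =
      ((QFM (fibKEEQMin G r) 𝒯).filter fun q => EBFM (fibKEEQMin G r) q ∈
        φX ends σ h u U p G F ⁻¹' 𝓔).image (crossReal ends u U p G F σ) := by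
    ext ζ
    simp only [blockCX, hQ, Finset.mem_filter, Finset.mem_image, Finset.mem_univ, true_and,
      Set.mem_preimage]
    constructor
    · rintro ⟨⟨q, ⟨hqR, hqB⟩, rfl⟩, hq, hE⟩
      refine ⟨q, ⟨⟨hqR, hqB, hq⟩, ?_⟩, rfl⟩
      rw [hb.blueEdges_crossRealM hup hcross hqB] at hE
      rw [EBFM_Q]
      exact hE
    · rintro ⟨q, ⟨⟨hqR, hqB, hq⟩, hE⟩, rfl⟩
      refine ⟨⟨q, ⟨hqR, hqB⟩, rfl⟩, hq, ?_⟩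
      rw [hb.blueEdges_crossRealM hup hcross hqB]
      rw [EBFM_Q] at hE
      exact hE
  rw [e1, e2, Finset.card_image_of_injective _ hinj, Finset.card_image_of_injective _ hinj]
  exact key

/-- **The block theorem with the mark at a dropped vertex, connected cross graph**: from
`ineqM_fibKEEQ`. -/
theorem CrossBase.rigid_block_crossQ (hG : G.Connected) (r : X)
    (hup : ∀ i, ∃ e, ends e = s(u, p i))
    (hcross : ∀ i j, G.Adj i j → ∃ e, ends e = s(p i, p j))
    (hcrossE : ∀ s : G.edgeSet, ∃ e, e ∈ clsCX ends p G s)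
    (hFe : ∀ k, ∃ e, e ∈ touches ends (F k)) (hext : ∀ i, ∃ e, e ∈ clsExtX ends u p i)
    {l : V} (hl : l ∉ strX h u U p F) {𝓔 : Set (Set E)} (h𝓔 : IsUpperSet 𝓔) :
    ((blockCX ends σ u U p G F).filter fun ζ =>
        ζ ∈ (tgtU ends l h {S : Set V | p r ∈ S} : Set (Config E)) ∧
          redEdges ends ζ h ∈ 𝓔).card ≤
      ((blockCX ends σ u U p G F).filter fun ζ =>
        ζ ∈ (tgtU ends l h {S : Set V | p r ∈ S} : Set (Config E)) ∧
          blueEdges ends ζ h ∈ 𝓔).card :=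
  hb.rigid_block_crossMQ (ineqM_fibKEEQ G hG r) hup hcross hcrossE hFe hext hl h𝓔

end Block

end CrossArm

end Summit.Ventures.PercRepro2
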